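import Mathlib
import HarnessLib
import HarnessLib.Audit
import Summits.CriticalPhenomena.Statement
import Summits.CriticalPhenomena.Ising3DConformalLimit.Theorems.HyperoctahedralRPExistsScaleCovariantLimitSplitGlue
import HarnessLib.Audit.Status.Attr

/-!
Route: TauBallRounding

DORMANT since 2026-08-29T19:32:23Z (census g0: costume|duplicate of route-CriticalPhenomena-HyperoctahedralRP; reader census-reader-36-g0) — unstaffed, not closed; items shared with open routes are served there. `ledger route dormant <id> --off` reactivates.

# Route TauBallRounding — the τ-ball rounds monotonically: O(3) at β_c from a monotone anisotropy
ratio of the subcritical inverse correlation length plus a UV-crossover bridge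

It suffices to show X_τ = (T1) ∧ (T2) ∧ (B) ∧ (C) ∧ (D) ∧ (E) (card
tau-ball-rounding-subcritical-isotropy, spine). For 0 < β < β_c(3) let
τ_β(x) := lim_n −n⁻¹ log⟨σ₀σ_{nx}⟩⁺_β (x ∈ ℤ³; exists by GKS-II supermultiplicativity, > 0 by ABF
sharpness, extends to a norm on ℝ³).
(T1) MONOTONE ROUNDING: for every x ≠ 0, β ↦ τ_β(x)/τ_β(e₁) is non-increasing on (0, β_c) (from |x|₁
at β = 0⁺: the unit ball starts as the
octahedron). (T2) ROUND ENDPOINT: given (T1), τ_β(x)/(τ_β(e₁)‖x‖₂) → 1 as β ↑ β_c for every x ≠ 0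
(the ball ends as the sphere; = isotropy of the
near-critical mass shell). (B) ROUNDNESS TRANSFER (the bet): (T2)'s conclusion ⇒ every normalised,
non-degenerate, translation-invariant,
scale-covariant pointwise scaling limit of criticalCorr 3 is O(3)-invariant. (C) such a limit exists
with some Δ > 0 (no rotation clause; shared item
1981), (D) inversion upgrade, normalised (shared 1982), (E) U₄ ≢ 0 (shared 0636). Then (C) gives ρ,
Δ, S; (B)∘(T2)∘(T1) gives IsRotationInvariant S,
hence IsEuclideanInvariant S; (D) gives inversion covariance; (E) gives HasNontrivialU4 S:
Ising3DConformalLimit.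
Lean: `MonotoneRounding ∧ RoundEndpoint ∧ RoundnessTransfer ∧ ExistsScaleCovariantLimit ∧
InversionUpgradeNormalised ∧ IsingEuclidUpgradeR4NonGaussian` (the six decls below, over
Literature.Probability.LatticeModels.{twoPointPlus, criticalBeta, Site, CorrFamily,
HasPointwiseScalingLimit, criticalCorr, NonCoincident, IsNondegenerateTwoPoint,
IsTranslationInvariant, IsScaleCovariant, IsRotationInvariant, IsEuclideanInvariant,
IsInversionCovariant, HasNontrivialU4}, Filter.Tendsto, AntitoneOn, nhdsWithin, Pi.single — all
`lean search --decl`-verified; Sketch.lean elaborates rc 0 with a term proof `assembly_proof` of the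
Assembly, axioms propext/Classical.choice/Quot.sound)

## Assembly
Pure logic, proved sorry-free in the planner's Sketch.lean (`assembly_proof`): take ρ, Δ, S with the
listed properties from (C);
RoundEndpoint applied to MonotoneRounding gives the round τ; RoundnessTransfer gives
IsRotationInvariant S, so IsEuclideanInvariant S :=
⟨translation, rotation⟩; InversionUpgradeNormalised gives IsInversionCovariant Δ S;
IsMoebiusCovariant Δ S := ⟨Euclid, scale, inversion⟩
(ConformalCovariance.lean); IsingEuclidUpgradeR4NonGaussian gives HasNontrivialU4 S; conclude
CritIsing3DConformalLimit = Ising3DConformalLimit.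

Rationale: WHY THIS LINE. Clause (ii) of the conjunct needs O(3); on ℤ³ rotation invariance of the critical
limit is only postulated (DuminilCopinICM2022 §8.1 p.25) and the
routes in hand attack it AT β_c (HyperoctahedralRP: nine-mirror reflection positivity;
IsingEuclidUpgrade r2: pure power law). This line attacks
the angular question from β < β_c, where the two-point function is quantitatively understood: τ_β is
a norm with analytic, strictly convex unit
ball and sharp Ornstein–Zernike asymptotics (CampaninoIoffeVelenik2003 Thm 1, Thm 2; Paesleme1978),
sandwiched between octahedron and cube
(MessagerMiracleSoleJSP1977), and physics predicts restoration of isotropy with a RATE ξ^{−ρ}, ρ =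
2+η−η₄ ≈ 2 (CampostriniEtAl1998 §1 p.4, §4.8).
The new object is a monotone functional of a one-parameter deformation: the anisotropy ratio
τ_β(x)/τ_β(e₁), conjectured non-increasing in β
(T1) — an inequality between two string energy densities ∂_β log τ_β, the kind of statement
correlation inequalities produce — with the round
sphere as its endpoint (T2); the solvable square lattice realises exactly this picture (Cheng–Wu
form of G, CampostriniEtAl1998 §4.7; ECS–ξ
duality Holzer1990, ZiaAvron1982: A₂(β) = −√2 log sinh 2β/(log coth β − 2β) ↓ 1, checked numerically
here). Imported areas: convex geometry of
norms/Wulff shapes, OZ renewal theory (probability), one-particle analysis of transfer matrices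
(BricmontFrohlich1985) for the bridge. What it does
that prior routes do not: a subcritical, RP-free engine for the rotational half of item 0634 with a
cheap numerical kill switch (T1); what it does
NOT do is hidden in (B): τ_β only sees |x| ≫ ξ(β), so carrying roundness down to the critical window
is an explicit, separately staffed bet.

RANKED CRUXES. #2 MonotoneRounding (crux) — (T1, card item T1, all directions) for every function τ
that is the directional rate τ β x = lim_n −n⁻¹ log⟨σ₀σ_{n x}⟩⁺_β on (0, β_c(3)) × ℤ³, and every x ≠
0, the map β ↦ τ β x / τ β e₁ is antitone on (0, β_c(3)): the τ-ball, normalised by its axis radius,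
only rounds (value |x|₁ at β = 0⁺, conjectured limit ‖x‖₂ at β_c). [difficulty: L] (why it might
fail: No inequality is known comparing the β-derivatives (fluctuation sums Σ_b⟨σ₀σ_nx;σ_b⟩) of log
τ_β along different strings; the ratio could be non-monotone at intermediate β in d=3, where only
the β→0 asymptotics and the solvable square lattice support it.) [CampaninoIoffeVelenik2003,
MessagerMiracleSoleJSP1977, CampostriniEtAl1998, Holzer1990, ZiaAvron1982]
#3 RoundEndpoint (crux) — (T2, card item T2) assuming MonotoneRounding: there is a directional-rate
function τ (as in T1) with τ β x/(τ β e₁ · ‖x‖₂) → 1 as β ↑ β_c(3) for every x ≠ 0 — the τ-unit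
ball, rescaled by its axis radius, converges to the Euclidean ball (isotropy of the near-critical
mass shell; CPRV's restoration exponent ρ > 0 in τ-language). T1 supplies existence of the limit
(monotone, MMS-bounded in [1/√3, √3]·const); the content is its value. [deps: MonotoneRounding]
[difficulty: open-problem] (why it might fail: Equivalent to an isotropic one-particle dispersion
relation of near-critical ℤ³ Ising (CPRV: deviations ∼ ξ^(−ρ), ρ = 2+η−η₄ ≈ 2, from HT series only);
rigorously only the MMS window 1/√3 ≤ ratio ≤ √3 is known, and T1 gives existence of the limit, not
its value 1.) [CampostriniEtAl1998, CampaninoIoffeVelenik2003, MessagerMiracleSoleJSP1977,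
DuminilCopinICM2022, WuEtAl1976]
#4 RoundnessTransfer (crux) — (B, the bridge; card item T3 made honest) if some directional-rate
function τ has round endpoint (conclusion of RoundEndpoint), then every pointwise scaling limit S of
criticalCorr 3 (ρ > 0 on (0,1]) that is normalised (S = 0 off NonCoincident), non-degenerate,
translation invariant and scale covariant with some Δ is IsRotationInvariant (all n). Intended
mechanism: roundness of τ_β = O(3)-invariant one-particle shell of the e₁- and diagonal transfer
matrices (Paes-Leme / Bricmont–Fröhlich particle analysis); one-particle saturation of ⟨σσ⟩ down to
|x| ≍ ξ; UV crossover of the near-critical family to the critical limit (G_β ↑ G_{β_c}); then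
2-point ⇒ n-point by nine-direction OS continuation. [deps: RoundEndpoint] [difficulty:
open-problem] (why it might fail: τ_β sees only |x| ≫ ξ(β): an RP lattice family with isotropic pole
but anisotropic multi-particle continuum has round τ-balls yet an anisotropic UV profile, so the
step needs Ising-specific UV crossover (near-critical → critical limit) and a 2-point → n-point
upgrade, both open in d = 3.) [CampostriniEtAl1998, Paesleme1978, BricmontFrohlich1985, WuEtAl1976,
GlimmJaffe1987, DuminilCopinICM2022]
#5 ExistsScaleCovariantLimit (crux) — (C, shared with HyperoctahedralRP item 1981, same text) there
are ρ > 0 on (0,1], Δ > 0 and S with HasPointwiseScalingLimit (criticalCorr 3) ρ S, S = 0 off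
NonCoincident, IsNondegenerateTwoPoint S, IsTranslationInvariant S, IsScaleCovariant Δ S — existence
and scale covariance WITHOUT a rotation clause (isotropy is output of this route). [difficulty:
open-problem] (why it might fail: Full δ→0⁺ convergence with ONE continuous Δ is open on ℤ³: only
subsequential limits follow from the two-point bounds, and RP/GKS two-point axiomatics admit
log-periodic (discretely scale covariant) profiles (card rp-cannot-fix-the-scale-log-periodic).)
[DuminilCopinICM2022, DuminilcopinPanis2025, arXiv:1912.07973, AizenmanDuminilCopinAnnals2021]
#6 InversionUpgradeNormalised (crux) — (D, shared with HyperoctahedralRP item 1982, same text) every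
pointwise scaling limit S of criticalCorr 3 (ρ > 0 on (0,1]) that is normalised, non-degenerate,
Euclidean invariant and scale covariant with Δ is IsInversionCovariant Δ (hence Möbius) — the
correctly typed inversion upgrade (U) of IsingEuclidUpgrade. [difficulty: open-problem] (why it
might fail: Scale + RP + Euclid ⇏ Möbius in general (free Maxwell d=3; RP descendant witnesses); for
Ising it fails if the limit carries a virial current of dimension exactly 2 or lacks a local stress
tensor — excluded only by Monte-Carlo (Δ_V > 5).) [ElshowkNakayamaRychkov2011, Nakayama2015,
DelamotteTissierWschebor2016, PolandRychkovVichi2019, DuminilCopinICM2022]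
#7 IsingEuclidUpgradeR4NonGaussian (crux) — (E, shared item stmt-CriticalPhenomena-0636, same text)
every non-degenerate pointwise scaling limit S of the renormalised critical Ising correlators on ℤ³
has connected four-point function U₄ ≢ 0 on non-coincident configurations. [difficulty:
open-problem] (why it might fail: No proof that U₄ ≢ 0 in d = 3: the double-current intersection
probability at macroscopic separation must stay > 0 as δ → 0; RP long-range models ON ℤ³ (α < 3/2)
are Gaussian (LongRangeTrivialityOnZ3).) [AizenmanDuminilCopinAnnals2021, DuminilCopinICM2022]
#9 RateExistsPositive (support) — (non-vacuity of T1/T2, provable now) there is τ : ℝ → ℤ³ → ℝ with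
−n⁻¹ log⟨σ₀σ_{nx}⟩⁺_β → τ β x for all 0 < β < β_c(3) and x (Fekete's lemma on the subadditive
sequence −log⟨σ₀σ_{nx}⟩, from twoPointPlus_mul_le_twoPointPlus and ⟨σ₀σ_y⟩⁺_β > 0), and τ β x > 0
for x ≠ 0 (twoPoint_exponentialDecay_of_lt_criticalBeta_holds = ABF sharpness, plus ⟨·⟩⁺ = ⟨·⟩^∅
below β_c). [difficulty: provable-now] [CampaninoIoffeVelenik2003, FriedliVelenik2017,
Literature.Probability.LatticeModels.twoPointPlus_mul_le_twoPointPlus,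
Literature.Probability.LatticeModels.twoPoint_exponentialDecay_of_lt_criticalBeta_holds]
#9 PlanarExactRounding (support) — (the solvable rung, pure real analysis) on the square lattice
above T_c the axis rate is log coth β − 2β and the diagonal rate per step is −log sinh² 2β
(McCoy–Wu; Cheng–Wu pole curve cosh q₁ + cosh q₂ = (1+z²)²/(2z(1−z²)), z = tanh β,
CampostriniEtAl1998 §4.7), so the planar anisotropy ratio is A₂(β) = −√2 log sinh 2β / (log coth β −
2β); CLAIM: A₂ is antitone on (0, log(1+√2)/2) and A₂(β) → 1 as β ↑ log(1+√2)/2 (numerically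
verified on a 2·10⁴-point grid by the planner). The exact-solution identification is documentation;
the item is the calculus fact. [difficulty: M] [MccoyWu1973, CampostriniEtAl1998, Holzer1990,
ZiaAvron1982, WuEtAl1976]

TWO-LAYER PLAN. Foreseen glued splits (nothing filed now; k ≤ 2, depth 1): RoundnessTransfer ⇐
[round τ → two-point isotropy of the limit, i.e. the text of
HyperoctahedralRP's support item TwoPointLimitIsotropic (stmt 1984, shared node)] → [two-point
isotropy → IsRotationInvariant of normalised
limits (nine-direction OS continuation, or card rotations-are-boosts-modular)] → RoundnessTransfer.
RoundEndpoint ⇐ [AxisSlowest: τ_β(x) ≥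
τ_β(e₁)‖x‖₂ for all β < β_c, x (liminf ≥ 1; open even this: GKS/RP give only ‖x‖_∞)] → [limsup ≤ 1
along one sequence β_k ↑ β_c] →
RoundEndpoint. MonotoneRounding ⇐ [differentiability of β ↦ τ_β(x) on (0, β_c) with the
fluctuation-sum formula] → [the string inequality
∂_β log τ_β(x) ≤ ∂_β log τ_β(e₁)] → MonotoneRounding. The route is one engine (r2–r4) on the shared
spine (r5–r7, already staffed by
HyperoctahedralRP / IsingEuclidUpgrade) — six cruxes, not two theses.

KILL CRITERIA. A certified β-interval in (0, β_c(3)) and a direction x on which τ_β(x)/τ_β(e₁)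
increases refutes MonotoneRounding and closes the route
(`close --reason refuted:MonotoneRounding`: the monotone deformation IS the mechanism; T2 survives
only as CPRV's bare prediction). ¬RoundEndpoint
(a residual mass-shell anisotropy at β_c⁻) would be evidence against clause (ii) itself — file it on
the conjunct's negative side; every
isotropy route is then in trouble. RoundnessTransfer cannot be refuted as typed without refuting
two-point isotropy of the critical limit; but a
model-blind witness (GKS-supermultiplicative, MMS-monotone, nine-mirror-RP lattice family with round
τ-balls and anisotropic critical profile)
shows it has no mechanism short of the near-critical scaling limit — then close `exhausted` unless a
UV-crossover engine is on the table, and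
record the witness as a barrier entry 'mass-shell isotropy ⇏ critical isotropy'. (C), (D), (E) are
shared: their refutation kills the
conjunct or all routes alike. TwoPointLimitIsotropic proved via HyperoctahedralRP moots r2–r4 for
the summit (T1, T2 keep independent value).

NOT DECOMPOSED YET. Regularity of β ↦ τ_β(x) (analyticity below β_c is expected from CIV-type
renewal/analytic perturbation but is not an item), the
fluctuation-sum representation of ∂_β τ_β, the string-comparison inequality behind T1, AxisSlowest,
the near-critical (massive) scaling limit
and its one-particle structure, the n-point OS machinery — all layer-2 children or prover lemmas
(`--supports`). No target item: X is the
conjunction of the six cruxes. Definition request dirInvCorrLength (below) would shorten every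
signature but is not load-bearing.

CHEAPEST FALSIFIER. (a) 3D numerics on T1: Monte Carlo (or the published high-temperature series)
for ξ along (1,0,0), (1,1,0), (1,1,1) at five values β ∈
[0.10, 0.21] on L ≥ 64 periodic boxes — one β-step where τ_diag/τ_axis increases kills r2; the
strong-coupling non-spherical moments of
CampostriniEtAl1998 §4 are the nearest existing data (they give the RATE near β_c, not
monotonicity). (b) The planar rung: PlanarExactRounding is
a one-variable calculus check — run by the planner numerically (2·10⁴-point grid on (0, β_c(2)):
monotone, limit 1; A₂(10⁻⁴) = 1.308,
A₂(0.3) = 1.0082, A₂(0.44) = 1.0000002); a symbolic proof or a counterexample on the triangular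
lattice (Holzer1990 duality) is half a page.
(c) Against r4: write down an RP, GKS-compatible lattice two-point family with round τ_β and
anisotropic short-distance profile (isotropic
pole × anisotropic entire factor) — if it also passes MMS and supermultiplicativity, r4 is
mechanism-free as typed.

NUMBERS. ρ = 2 + η − η₄ ≈ 2 with ≈1% deviations (d = 3, CampostriniEtAl1998 §1 p.4, §4.8); ρ = 2
exactly for the square-lattice Ising model
(§4.7); η ≈ 0.0363, ν ≈ 0.6300 (KosPolandSimmonsDuffinVichi2016); β_c(ℤ³) ≈ 0.221655 (Monte Carlo,
arXiv:1806.03558); MMS window for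
the normalised ratio: 1/√3 ≤ τ_β(x)/(τ_β(e₁)‖x‖₂)·(‖x‖₂/‖x‖_∞)⁻¹ and τ_β(x) ≤ τ_β(e₁)‖x‖₁
(MessagerMiracleSoleJSP1977); endpoints of
the ratio for x = (1,1,1): √3 = 1.732 at β = 0⁺, conjectured 1 at β_c; planar: √2 → 1, A₂(β) − 1 ∼
c(β_c − β)² (ρ = 2). Rigorous
critical window on ℤ³: c‖x‖⁻² ≤ ⟨σ₀σ_x⟩_{β_c} ≤ C‖x‖⁻¹ (criticalTwoPoint bounds,
DuminilcopinPanis2025). Items at open: 9 (6 cruxes,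
2 support, 1 assembly).

DEFINITION REQUESTS. dirInvCorrLength d β x := lim_n −n⁻¹ log⟨σ₀σ_{n x}⟩⁺_β (directional inverse
correlation length; CorrelationDecay.lean has only the
axis liminf `invCorrLength`) in Literature/Probability/LatticeModels, with the norm package
(subadditivity, evenness, positive homogeneity,
extension to ℝ^d) — `ledger workitem add --kind definition --notion dirInvCorrLength`, filed after
open for MonotoneRounding. Cite fact
wanted later: CampaninoIoffeVelenik2003 Thm 2 (strict convexity and local analyticity of the τ_β
unit sphere, β < β_c).

Novelty: Searches (2026-08-15): `lit galaxy search "anisotropy of the correlation length" --star all` (4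
hits, liquid-crystal/scattering books, none
relevant); `lit galaxy search "restoration of rotational symmetry" --star all` (13: lattice QCD /
nuclear mean-field, none on Ising τ);
`lit search --source zbmath "Ornstein-Zernike theory Ising"` (15: CampaninoIoffeVelenik2003,
doi:10.1214/22-aihp1345, doi:10.1007/s00220-019-03596-0,
Paesleme1978, BricmontFrohlich1985 …); `… "anisotropy correlation length Ising"` (13, none
relevant); `… "angular dependence correlation length
Ising"` (1: Paesleme1978); `lit search --source crossref "correlation length equilibrium crystal
shape duality Ising exact"` (Holzer1990,
doi:10.1103/physrevlett.64.1189, ZiaAvron1982, doi:10.1007/bf01020575); `lit vsearch` on "inverse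
correlation length is a norm / OZ in every
direction" (textbooks only); `lit frontier CriticalPhenomena --since 2021` (30 rows,
planar/SLE/percolation only); `lit read` of
arXiv:cond-mat/9705086 pp.4,7,9,20–21 and arXiv:math/0111274 p.3; OpenAlex/arXiv APIs rate-limited
(HTTP 429) this session; the card's own
crossref sweep and the refuter audit (doi:10.1214/08-aop449, doi:10.1214/ecp.v18-3163 planar
rounding via conformal invariance) re-used.
Nearest prior art found: CampostriniEtAl1998 (restoration of rotational invariance of G(x) as β →
β_c with rate M^ρ, ρ = 2+η−η₄; 2D ρ = 2
via the Cheng–Wu form) — the phenomenology of (T2) with its rate, no monotonicity, no theorem;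
CampaninoIoff  [refs: 10.1214/22-aihp1345, 10.1007/s00220-019-03596-0, 10.1103/physrevlett.64.1189, 10.1007/bf01020575, 10.1214/08-aop449, 10.1214/ecp.v18-3163, cond-mat/9705086, math/0111274, doi:10.1214/22-aihp1345, doi:10.1007/s00220-019-03596-0, doi:10.1103/physrevlett.64.1189, doi:10.1007/bf01020575, doi:10.1214/08-aop449, doi:10.1214/ecp.v18-3163, CampaninoIoffeVelenik2003, Paesleme1978, BricmontFrohlich1985, Hol]

Barriers (technique_class: subcritical-deformation, oz-anisotropy): - technique_class: subcritical-deformation, oz-anisotropy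
- Literature.Barriers.CriticalPhenomena.ScaleCovarianceNotMoebius: bites only on r6 (shared
inversion crux), which keeps HasPointwiseScalingLimit (criticalCorr 3) and the NonCoincident
normalisation demanded by Theorems/IsingEuclidUpgradeRefutations.lean — outside the model-blind
class EuclideanScaleUpgrade; r2–r4 concern O(3), not the inversion.
- Literature.Barriers.CriticalPhenomena.LiouvilleRigidity: respected — no conformal maps, discrete
holomorphicity or SLE; isotropy is attacked through a convex body deforming in β, a mechanism that
exists in every dimension.
- Literature.Barriers.CriticalPhenomena.LongRangeTrivialityOnZ3: evaded structurally — the engine is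
NOT interaction-uniform: for the RP long-range couplings J ∝ ‖x‖₁^(−3−α) the two-point function
decays polynomially at every β, τ_β ≡ 0 and the τ-ball does not exist; this is also how the line
avoids the in-house anisotropic Gaussian witnesses (card interaction-blind-scale-isotropy-barrier),
whose couplings are ℓ¹-anisotropic and long-range.
- Literature.Barriers.CriticalPhenomena.IsingTrivialityFromDimensionFour: not engaged by r2–r4
(isotropy holds in every d, so a dimension-uniform proof of T1/T2 would be welcome); it bears on r7
(U₄ ≢ 0), shared and attacked elsewhere with d = 3 input.
- Literature.Barriers.CriticalPhenomena.RigorousRGSmallParameter: no RG and no small parameter; the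
bet replacing it is monotonicity in β (T1) plus the UV-crossover bridg

History (route lifecycle, newest last):
- 2026-08-25T16:10:38Z · DORMANT — reconciler: no traction for 7.8 d (last activity item-evidence-added at 2026-08-17T19:18:53Z); parked, not closed — `ledger route dormant route-CriticalPhenomen (operator:999:2892950)
- 2026-08-27T13:37:14Z · REACTIVATED — reconciler: reactivated — activity statement-claimed at 2026-08-27T11:07:20Z after parking at 2026-08-25T16:10:38Z (operator:999:3531624)
- 2026-08-29T19:32:23Z · DORMANT — census g0: costume|duplicate of route-CriticalPhenomena-HyperoctahedralRP; reader census-reader-36-g0 (operator:999:1178140)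

sub-problem: Ising3DConformalLimit · status: dormant · opened planner-plancard-CriticalPhenomena-Ising3DCon-1ac281f3-0 2026-08-15T11:35:08Z · rev 2 · ledger route-CriticalPhenomena-TauBallRounding
GENERATED by the gate from the ledger (D-0016/17). Provers cite these decls: `theorem foo : Summit.CriticalPhenomena.Ising3DConformalLimit.Theses.TauBallRounding.<Decl> := …` in Summits/CriticalPhenomena/Ising3DConformalLimit/Theorems/<Name>.lean.
-/

namespace Summit.CriticalPhenomena.Ising3DConformalLimit.Theses.TauBallRounding

open scoped BigOperators Topology Manifold Classical MeasureTheory ProbabilityTheory Matrix InnerProductSpace ComplexConjugate ContinuousMap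
open Filter Set Function TopologicalSpace MeasureTheory

attribute [summit_statement] _root_.Ising3DConformalLimit

/-- item stmt-CriticalPhenomena-4807 · crux · rank 2 · open · by planner
why it might fail: No inequality is known comparing the β-derivatives (fluctuation sums Σ_b⟨σ₀σ_nx;σ_b⟩) of log τ_β along different strings; the ratio could be non-monotone at intermediate β in d=3, where only the β→0 asymptotics and the solvable square lattice support it.
sources: CampaninoIoffeVelenik2003, MessagerMiracleSoleJSP1977, CampostriniEtAl1998, Holzer1990, ZiaAvron1982
[crux] (T1, card item T1, all directions) for every function τ that is the directional rate τ β x =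
lim_n −n⁻¹ log⟨σ₀σ_{n x}⟩⁺_β on (0, β_c(3)) × ℤ³, and every x ≠ 0, the map β ↦ τ β x / τ β e₁ is
antitone on (0, β_c(3)): the τ-ball, normalised by its axis radius, only rounds (value |x|₁ at β =
0⁺, conjectured limit ‖x‖₂ at β_c). [difficulty: L] -/
@[route_item "route-CriticalPhenomena-TauBallRounding", crux]
def MonotoneRounding : Prop :=
  ∀ τ : ℝ → Literature.Probability.LatticeModels.Site 3 → ℝ, (∀ (β : ℝ) (x : Literature.Probability.LatticeModels.Site 3), 0 < β → β < Literature.Probability.LatticeModels.criticalBeta 3 → Filter.Tendsto (fun n : ℕ => -Real.log (Literature.Probability.LatticeModels.twoPointPlus 3 β ((n : ℤ) • x)) / (n : ℝ)) Filter.atTop (nhds (τ β x))) → ∀ x : Literature.Probability.LatticeModels.Site 3, x ≠ 0 → AntitoneOn (fun β : ℝ => τ β x / τ β (Pi.single 0 1)) (Set.Ioo 0 (Literature.Probability.LatticeModels.criticalBeta 3))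

/-- item stmt-CriticalPhenomena-4808 · crux · rank 3 · open · by planner
why it might fail: Equivalent to an isotropic one-particle dispersion relation of near-critical ℤ³ Ising (CPRV: deviations ∼ ξ^(−ρ), ρ = 2+η−η₄ ≈ 2, from HT series only); rigorously only the MMS window 1/√3 ≤ ratio ≤ √3 is known, and T1 gives existence of the limit, not its value 1.
sources: CampostriniEtAl1998, CampaninoIoffeVelenik2003, MessagerMiracleSoleJSP1977, DuminilCopinICM2022, WuEtAl1976
[crux] (T2, card item T2) assuming MonotoneRounding: there is a directional-rate function τ (as in
T1) with τ β x/(τ β e₁ · ‖x‖₂) → 1 as β ↑ β_c(3) for every x ≠ 0 — the τ-unit ball, rescaled by its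
axis radius, converges to the Euclidean ball (isotropy of the near-critical mass shell; CPRV's
restoration exponent ρ > 0 in τ-language). T1 supplies existence of the limit (monotone, MMS-bounded
in [1/√3, √3]·const); the content is its value. [deps: MonotoneRounding] [difficulty: open-problem] -/
@[route_item "route-CriticalPhenomena-TauBallRounding", crux]
def RoundEndpoint : Prop :=
  MonotoneRounding → ∃ τ : ℝ → Literature.Probability.LatticeModels.Site 3 → ℝ, (∀ (β : ℝ) (x : Literature.Probability.LatticeModels.Site 3), 0 < β → β < Literature.Probability.LatticeModels.criticalBeta 3 → Filter.Tendsto (fun n : ℕ => -Real.log (Literature.Probability.LatticeModels.twoPointPlus 3 β ((n : ℤ) • x)) / (n : ℝ)) Filter.atTop (nhds (τ β x))) ∧ ∀ x : Literature.Probability.LatticeModels.Site 3, x ≠ 0 → Filter.Tendsto (fun β : ℝ => τ β x / (τ β (Pi.single 0 1) * Real.sqrt (∑ i, ((x i : ℝ)) ^ 2))) (nhdsWithin (Literature.Probability.LatticeModels.criticalBeta 3) (Set.Iio (Literature.Probability.LatticeModels.criticalBeta 3))) (nhds 1)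

/-- item stmt-CriticalPhenomena-4809 · crux · rank 4 · open · by planner
why it might fail: τ_β sees only |x| ≫ ξ(β): an RP lattice family with isotropic pole but anisotropic multi-particle continuum has round τ-balls yet an anisotropic UV profile, so the step needs Ising-specific UV crossover (near-critical → critical limit) and a 2-point → n-point upgrade, both open in d = 3.
sources: CampostriniEtAl1998, Paesleme1978, BricmontFrohlich1985, WuEtAl1976, GlimmJaffe1987, DuminilCopinICM2022
[crux] (B, the bridge; card item T3 made honest) if some directional-rate function τ has round
endpoint (conclusion of RoundEndpoint), then every pointwise scaling limit S of criticalCorr 3 (ρ >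
0 on (0,1]) that is normalised (S = 0 off NonCoincident), non-degenerate, translation invariant and
scale covariant with some Δ is IsRotationInvariant (all n). Intended mechanism: roundness of τ_β =
O(3)-invariant one-particle shell of the e₁- and diagonal transfer matrices (Paes-Leme /
Bricmont–Fröhlich particle analysis); one-particle saturation of ⟨σσ⟩ down to |x| ≍ ξ; UV crossover
of the near-critical family to the critical limit (G_β ↑ G_{β_c}); then 2-point ⇒ n-point by
nine-direction OS continuation. [deps: RoundEndpoint] [difficulty: open-problem] -/
@[route_item "route-CriticalPhenomena-TauBallRounding", crux]
def RoundnessTransfer : Prop :=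
  (∃ τ : ℝ → Literature.Probability.LatticeModels.Site 3 → ℝ, (∀ (β : ℝ) (x : Literature.Probability.LatticeModels.Site 3), 0 < β → β < Literature.Probability.LatticeModels.criticalBeta 3 → Filter.Tendsto (fun n : ℕ => -Real.log (Literature.Probability.LatticeModels.twoPointPlus 3 β ((n : ℤ) • x)) / (n : ℝ)) Filter.atTop (nhds (τ β x))) ∧ ∀ x : Literature.Probability.LatticeModels.Site 3, x ≠ 0 → Filter.Tendsto (fun β : ℝ => τ β x / (τ β (Pi.single 0 1) * Real.sqrt (∑ i, ((x i : ℝ)) ^ 2))) (nhdsWithin (Literature.Probability.LatticeModels.criticalBeta 3) (Set.Iio (Literature.Probability.LatticeModels.criticalBeta 3))) (nhds 1)) → ∀ (ρ : ℝ → ℝ) (Δ : ℝ) (S : Literature.Probability.LatticeModels.CorrFamily 3), (∀ δ ∈ Set.Ioc (0:ℝ) 1, 0 < ρ δ) → Literature.Probability.LatticeModels.HasPointwiseScalingLimit (Literature.Probability.LatticeModels.criticalCorr 3) ρ S → (∀ n z, z ∉ Literature.Probability.LatticeModels.NonCoincident 3 n → S n z = 0) → Literature.Probability.LatticeModels.IsNondegenerateTwoPoint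 S → Literature.Probability.LatticeModels.IsTranslationInvariant S → Literature.Probability.LatticeModels.IsScaleCovariant Δ S → Literature.Probability.LatticeModels.IsRotationInvariant S

/-- item stmt-CriticalPhenomena-1981 · crux · rank 5 · SPLIT (gen 3) into TwoPointDoubling, ClusterSetTotallyDisconnected + glue Summit.CriticalPhenomena.Ising3DConformalLimit.Cruxes.ExistsScaleCovariantLimit.SplitGlue.hrp_crux_of_doubling_of_totallyDisconnected · direct attempts still welcome (low priority) · by planner
why it might fail: Full δ→0⁺ convergence with ONE continuous Δ is open on ℤ³: only subsequential limits follow from the two-point bounds, and RP/GKS two-point axiomatics admit log-periodic (discretely scale covariant) profiles (card rp-cannot-fix-the-scale-log-periodic).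
sources: DuminilCopinICM2022, DuminilcopinPanis2025, arXiv:1912.07973, AizenmanDuminilCopinAnnals2021
earlier split gen 1: TwoPointDoubling, ClusterSetTotallyDisconnected — retired -
earlier split gen 2: TwoPointDoubling, ClusterSetTotallyDisconnected — retired -
[crux r4, (C), existence WITHOUT rotations] There are ρ > 0 on (0,1], Δ > 0 and S with
HasPointwiseScalingLimit (criticalCorr 3) ρ S, S = 0 off NonCoincident, IsNondegenerateTwoPoint S,
IsTranslationInvariant S, IsScaleCovariant Δ S. Strictly weaker than CritIsing3DEuclideanLimit (item
0638: rotations included) — on this route isotropy is OUTPUT. Inputs in tree: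
criticalTwoPoint_bounds_holds (c|x|⁻² ≤ G ≤ C|x|⁻¹ ⇒ subsequential limits, Δ ∈ [1/2,1]); missing:
uniqueness/full-filter convergence and continuous scale covariance (DuminilCopinICM2022 §8.4 p.29:
'widely open'). -/
@[route_item "route-CriticalPhenomena-TauBallRounding", crux]
def ExistsScaleCovariantLimit : Prop :=
  ∃ (ρ : ℝ → ℝ) (Δ : ℝ) (S : Literature.Probability.LatticeModels.CorrFamily 3), (∀ δ ∈ Set.Ioc (0:ℝ) 1, 0 < ρ δ) ∧ 0 < Δ ∧ Literature.Probability.LatticeModels.HasPointwiseScalingLimit (Literature.Probability.LatticeModels.criticalCorr 3) ρ S ∧ (∀ n z, z ∉ Literature.Probability.LatticeModels.NonCoincident 3 n → S n z = 0) ∧ Literature.Probability.LatticeModels.IsNondegenerateTwoPoint S ∧ Literature.Probability.LatticeModels.IsTranslationInvariant S ∧ Literature.Probability.LatticeModels.IsScaleCovariant Δ S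

-- parent: ExistsScaleCovariantLimit · child (gen 3)
/--     item stmt-CriticalPhenomena-6150 · crux · rank 501 · open
    parent: ExistsScaleCovariantLimit · by planner
    why it might fail: Open in print (ADC21 Rem 5.10; DCP24 Thm 1.5: η's existence open): every two-point axiomatic in tree (nine-mirror RP, MMS, IR/SSIR, c‖x‖⁻²≤G≤C‖x‖⁻¹, DCP24 1.2–1.3) is passed by completely monotone fat Yukawa mixtures losing doubling by unbounded factors (barrier p149925).
    sources: AizenmanDuminilCopinAnnals2021, arXiv:1912.07973, DuminilcopinPanis2025, arXiv:2404.05700, arXiv:2509.02850, DuminilCopinICM2022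
[crux] (D) ALL-SCALE DOUBLING of the axial critical two-point function on ℤ³: there is κ > 0 with
g(2n) ≥ κ·g(n) for all n ≥ 1, g(n) := ⟨σ₀σ_{n e₁}⟩⁺_{β_c(3)} (card item M3; = D1 of card
every-scale-regular-multiplicative-fekete). With MMS it gives G(z′) ≍ G(z) for ‖z′‖ ≍ ‖z‖ in all
directions; it is the one open LATTICE input of the compactness half and is filed first (the import
cone of everything below is otherwise proved: criticalTwoPoint_bounds_holds,
messager_miracleSole_holds, RP lemmas). [difficulty: open-problem] -/
@[route_item "route-CriticalPhenomena-TauBallRounding", crux]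
def TwoPointDoubling : Prop :=
  ∃ κ : ℝ, 0 < κ ∧ ∀ n : ℕ, 1 ≤ n → κ * Literature.Probability.LatticeModels.criticalTwoPoint 3 (Pi.single 0 (n : ℤ)) ≤ Literature.Probability.LatticeModels.criticalTwoPoint 3 (Pi.single 0 (2 * (n : ℤ)))

-- parent: ExistsScaleCovariantLimit · child (gen 3)
/--     item stmt-CriticalPhenomena-4659 · crux · rank 502 · open
    parent: ExistsScaleCovariantLimit · by planner
    why it might fail: Under compactness TD ⟺ singleton cluster set ⟺ full convergence: fails if Δ drifts along scales, if the zoom has a limit cycle (W_ε-type DSI witnesses pass all two-point axiomatics with two cluster points, Disproof §E), or if cluster points evade locality; isolation of local 3D CFTs is unproved.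
    sources: Rychkov2020, arXiv:2007.14315, PolandRychkovVichi2019, arXiv:1805.04405, DuminilCopinICM2022, Literature.Probability.LatticeModels.PointwiseScalingLimitDiscreteScaleInvariance
[crux] the cluster set 𝒞 of the self-normalised family is totally disconnected in the pointwise
(product) topology of CorrFamily 3 (on 𝒞, compact under Reg, this coincides with the locally uniform
topology; pointwise is the stronger ask otherwise). INTENDED ENGINE (card items (2)–(4), the route's
point, layer 2): 𝒞 ⊆ 𝓘 := σ-correlator families of LOCAL unitary ℤ₂-symmetric 3D CFTs with exactly
one relevant odd and exactly one relevant non-identity even scalar and Δ_σ ≤ 1 (lattice side: OS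
positivity, clustering, covariance and spectrum of cluster points), and 𝓘 is totally disconnected
(CFT side, lattice-blind: 'It is expected that most local CFTs are isolated. One exception are CFTs
with exactly marginal fields of dimension Δ = d … A folk conjecture says that exactly marginal
fields in d ≥ 3 require supersymmetry' — Rychkov2020, arXiv:2007.14315 p.8, read this session; LOCAL
= 'critical points of lattice models with finite-range interactions', ibid., which is what excludes
the non-local long-range arc; an ANALYTIC isolation theorem for exact solutions of crossing — NOT a
finite-Λ positivity certificate, which only gives diam ≤ ε(Λ): refuter flag on the card, accepted).
Both halves -/
@[route_item "route-CriticalPhenomena-TauBallRounding", crux]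
def ClusterSetTotallyDisconnected : Prop :=
  IsTotallyDisconnected {S : Literature.Probability.LatticeModels.CorrFamily 3 | (∀ n x, x ∉ Literature.Probability.LatticeModels.NonCoincident 3 n → S n x = 0) ∧ ∃ u : ℕ → ℝ, (∀ k, u k ∈ Set.Ioc (0:ℝ) 1) ∧ Filter.Tendsto u Filter.atTop (nhds 0) ∧ ∀ n, TendstoLocallyUniformlyOn (fun k => Literature.Probability.LatticeModels.rescaledCorrelator (Literature.Probability.LatticeModels.criticalCorr 3) (fun δ : ℝ => (Literature.Probability.LatticeModels.criticalTwoPoint 3 (Pi.single 0 ⌊δ⁻¹⌋)) ^ (-(1/2:ℝ))) n (u k)) (S n) Filter.atTop (Literature.Probability.LatticeModels.NonCoincident 3 n)}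

/-- glue for the split of `ExistsScaleCovariantLimit`: landed theorem `Summit.CriticalPhenomena.Ising3DConformalLimit.Cruxes.ExistsScaleCovariantLimit.SplitGlue.hrp_crux_of_doubling_of_totallyDisconnected`. -/
theorem ExistsScaleCovariantLimitGlueBy_holds : TwoPointDoubling → ClusterSetTotallyDisconnected → ExistsScaleCovariantLimit := _root_.Summit.CriticalPhenomena.Ising3DConformalLimit.Cruxes.ExistsScaleCovariantLimit.SplitGlue.hrp_crux_of_doubling_of_totallyDisconnected

/-- item stmt-CriticalPhenomena-1982 · crux · rank 6 · open · by planner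
why it might fail: Scale + RP + Euclid ⇏ Möbius in general (free Maxwell d=3; RP descendant witnesses); for Ising it fails if the limit carries a virial current of dimension exactly 2 or lacks a local stress tensor — excluded only by Monte-Carlo (Δ_V > 5).
sources: ElshowkNakayamaRychkov2011, Nakayama2015, DelamotteTissierWschebor2016, PolandRychkovVichi2019, DuminilCopinICM2022
[crux r5, (D), inversion upgrade re-typed] Every pointwise scaling limit S of criticalCorr 3 (ρ > 0
on (0,1]) that is normalised (S = 0 off NonCoincident), non-degenerate, Euclidean invariant and
scale covariant with Δ is IsInversionCovariant Δ (hence Möbius). This is (U) of route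
IsingEuclidUpgrade (item 0637, refuted AS TYPED by not_inversionUpgrade_of_euclideanLimit through
values on the coincident locus) with the normalisation hypothesis the refutation file prescribes;
the model-blind version is false (Literature.Barriers.CriticalPhenomena.ScaleCovarianceNotMoebius;
free Maxwell d=3, ElshowkNakayamaRychkov2011), so any proof must use the Ising hypothesis (RP +
locality / absence of a dimension-2 virial current: DelamotteTissierWschebor2016 §5–6,
Nakayama2015). -/
@[route_item "route-CriticalPhenomena-TauBallRounding", crux]
def InversionUpgradeNormalised : Prop :=
  ∀ (ρ : ℝ → ℝ) (Δ : ℝ) (S : Literature.Probability.LatticeModels.CorrFamily 3), (∀ δ ∈ Set.Ioc (0:ℝ) 1, 0 < ρ δ) → Literature.Probability.LatticeModels.HasPointwiseScalingLimit (Literature.Probability.LatticeModels.criticalCorr 3) ρ S → (∀ n z, z ∉ Literature.Probability.LatticeModels.NonCoincident 3 n → S n z = 0) → Literature.Probability.LatticeModels.IsNondegenerateTwoPoint S → Literature.Probability.LatticeModels.IsEuclideanInvariant S → Literature.Probability.LatticeModels.IsScaleCovariant Δ S → Literature.Probability.LatticeModels.IsInversionCovariant Δ S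

/-- item stmt-CriticalPhenomena-0636 · crux · rank 7 · open · by planner
why it might fail: No proof that U₄ ≢ 0 in d = 3: the double-current intersection probability at macroscopic separation must stay > 0 as δ → 0; RP long-range models ON ℤ³ (α < 3/2) are Gaussian (LongRangeTrivialityOnZ3).
sources: AizenmanDuminilCopinAnnals2021, DuminilCopinICM2022
Crux r4 (non-triviality in d=3): every non-degenerate pointwise scaling limit S of the renormalised
critical Ising correlators on Z^3 has connected four-point function U4 ≢ 0 on non-coincident
configurations. Intended tool: the random-current identity U4(x,y,z,t) =
−2⟨σxσy⟩⟨σzσt⟩·P^{xy,zt}[C_{n1+n2}(x) ∩ C_{n1+n2}(z) ≠ ∅] (Aizenman 1982; ADC2021 arXiv:1912.07973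
eq. (3.11)): non-Gaussianity ⇔ the intersection probability of the two double-current clusters at
macroscopic separation does not vanish as δ → 0. Contrast: for d ≥ 4 every such limit IS Gaussian
(Literature.Probability.LatticeModels.highDim_triviality). Its negation refutes the conjunct
Ising3DConformalLimit itself. -/
@[route_item "route-CriticalPhenomena-TauBallRounding", crux]
def IsingEuclidUpgradeR4NonGaussian : Prop :=
  ∀ (ρ : ℝ → ℝ) (S : Literature.Probability.LatticeModels.CorrFamily 3), (∀ δ ∈ Set.Ioc (0:ℝ) 1, 0 < ρ δ) → Literature.Probability.LatticeModels.HasPointwiseScalingLimit (Literature.Probability.LatticeModels.criticalCorr 3) ρ S → Literature.Probability.LatticeModels.IsNondegenerateTwoPoint S → Literature.Probability.LatticeModels.HasNontrivialU4 S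

/-- item stmt-CriticalPhenomena-4810 · support · rank 9 · closed · proved by Summit.CriticalPhenomena.Ising3DConformalLimit.Theorems.rateExistsPositive_proof @ b4d2876abc71 (prover) · by planner
sources: CampaninoIoffeVelenik2003, FriedliVelenik2017, Literature.Probability.LatticeModels.twoPointPlus_mul_le_twoPointPlus, Literature.Probability.LatticeModels.twoPoint_exponentialDecay_of_lt_criticalBeta_holds
[support] (non-vacuity of T1/T2, provable now) there is τ : ℝ → ℤ³ → ℝ with −n⁻¹ log⟨σ₀σ_{nx}⟩⁺_β →
τ β x for all 0 < β < β_c(3) and x (Fekete's lemma on the subadditive sequence −log⟨σ₀σ_{nx}⟩, from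
twoPointPlus_mul_le_twoPointPlus and ⟨σ₀σ_y⟩⁺_β > 0), and τ β x > 0 for x ≠ 0
(twoPoint_exponentialDecay_of_lt_criticalBeta_holds = ABF sharpness, plus ⟨·⟩⁺ = ⟨·⟩^∅ below β_c).
[difficulty: provable-now] -/
@[route_item "route-CriticalPhenomena-TauBallRounding"]
def RateExistsPositive : Prop :=
  ∃ τ : ℝ → Literature.Probability.LatticeModels.Site 3 → ℝ, (∀ (β : ℝ) (x : Literature.Probability.LatticeModels.Site 3), 0 < β → β < Literature.Probability.LatticeModels.criticalBeta 3 → Filter.Tendsto (fun n : ℕ => -Real.log (Literature.Probability.LatticeModels.twoPointPlus 3 β ((n : ℤ) • x)) / (n : ℝ)) Filter.atTop (nhds (τ β x))) ∧ ∀ (β : ℝ) (x : Literature.Probability.LatticeModels.Site 3), 0 < β → β < Literature.Probability.LatticeModels.criticalBeta 3 → x ≠ 0 → 0 < τ β x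

-- `RateExistsPositive` holds: proved by `Summit.CriticalPhenomena.Ising3DConformalLimit.Theorems.rateExistsPositive_proof` @ b4d2876abc71 (its module imports this route file, so no `_holds` link can be stated here).

/-- item stmt-CriticalPhenomena-4811 · support · rank 9 · closed · proved by Summit.CriticalPhenomena.Ising3DConformalLimit.Theorems.PlanarExactRounding_proof @ e7eb8dbbabe6 (prover) · by planner
sources: MccoyWu1973, CampostriniEtAl1998, Holzer1990, ZiaAvron1982, WuEtAl1976
[support] (the solvable rung, pure real analysis) on the square lattice above T_c the axis rate is
log coth β − 2β and the diagonal rate per step is −log sinh² 2β (McCoy–Wu; Cheng–Wu pole curve cosh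
q₁ + cosh q₂ = (1+z²)²/(2z(1−z²)), z = tanh β, CampostriniEtAl1998 §4.7), so the planar anisotropy
ratio is A₂(β) = −√2 log sinh 2β / (log coth β − 2β); CLAIM: A₂ is antitone on (0, log(1+√2)/2) and
A₂(β) → 1 as β ↑ log(1+√2)/2 (numerically verified on a 2·10⁴-point grid by the planner). The
exact-solution identification is documentation; the item is the calculus fact. [difficulty: M] -/
@[route_item "route-CriticalPhenomena-TauBallRounding"]
def PlanarExactRounding : Prop :=
  AntitoneOn (fun β : ℝ => -(Real.sqrt 2 * Real.log (Real.sinh (2 * β))) / (Real.log (Real.cosh β / Real.sinh β) - 2 * β)) (Set.Ioo 0 (Real.log (1 + Real.sqrt 2) / 2)) ∧ Filter.Tendsto (fun β : ℝ => -(Real.sqrt 2 * Real.log (Real.sinh (2 * β))) / (Real.log (Real.cosh β / Real.sinh β) - 2 * β)) (nhdsWithin (Real.log (1 + Real.sqrt 2) / 2) (Set.Iio (Real.log (1 + Real.sqrt 2) / 2))) (nhds 1)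

-- `PlanarExactRounding` holds: proved by `Summit.CriticalPhenomena.Ising3DConformalLimit.Theorems.PlanarExactRounding_proof` @ e7eb8dbbabe6 (its module imports this route file, so no `_holds` link can be stated here).

/-- item stmt-CriticalPhenomena-4812 · assembly · rank 1 · closed · proved by Summit.CriticalPhenomena.Ising3DConformalLimit.Theorems.tauBallRounding_assembly_proof @ 26c8c1dc6347 (prover) · by planner
sources: DuminilCopinICM2022, CampostriniEtAl1998
[assembly] MonotoneRounding → RoundEndpoint → RoundnessTransfer → ExistsScaleCovariantLimit →
InversionUpgradeNormalised → IsingEuclidUpgradeR4NonGaussian → Ising3DConformalLimit. -/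
@[route_item "route-CriticalPhenomena-TauBallRounding"]
def Assembly : Prop :=
  MonotoneRounding → RoundEndpoint → RoundnessTransfer → ExistsScaleCovariantLimit → InversionUpgradeNormalised → IsingEuclidUpgradeR4NonGaussian → Ising3DConformalLimit

-- `Assembly` holds: proved by `Summit.CriticalPhenomena.Ising3DConformalLimit.Theorems.tauBallRounding_assembly_proof` @ 26c8c1dc6347 (its module imports this route file, so no `_holds` link can be stated here).

/-! D-0027 §2.1 — DECIDING THEOREM (planner-authored via `route open/edit --closes-file`; by planner-rrepair-CriticalPhenomena-TauBallRound-b1a1f69d-g2-0 2026-08-15T16:54:52Z):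
its hypotheses are this route's items and its conclusion the sub-problem Statement (glue_lint), and it elaborates with this file. -/

@[closes "route-CriticalPhenomena-TauBallRounding"] theorem closes (h_MonotoneRounding : MonotoneRounding) (h_RoundEndpoint : RoundEndpoint)
    (h_RoundnessTransfer : RoundnessTransfer)
    (h_ExistsScaleCovariantLimit : ExistsScaleCovariantLimit)
    (h_InversionUpgradeNormalised : InversionUpgradeNormalised)
    (h_IsingEuclidUpgradeR4NonGaussian : IsingEuclidUpgradeR4NonGaussian) :
    _root_.Ising3DConformalLimit := by
  -- (C): a normalised, non-degenerate, translation-invariant, scale-covariant limit S exists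
  obtain ⟨ρ, Δ, S, hρ, hΔ, hlim, hnorm, hnd, htr, hsc⟩ := h_ExistsScaleCovariantLimit
  -- (T1) ⇒ (T2): the τ-ball has a round endpoint; (B) transfers roundness to O(3)-invariance of S
  have hrot : Literature.Probability.LatticeModels.IsRotationInvariant S :=
    h_RoundnessTransfer (h_RoundEndpoint h_MonotoneRounding) ρ Δ S hρ hlim hnorm hnd htr hsc
  have heuc : Literature.Probability.LatticeModels.IsEuclideanInvariant S := ⟨htr, hrot⟩
  -- (D): inversion covariance of the normalised Euclidean-invariant scale-covariant limit
  have hinv : Literature.Probability.LatticeModels.IsInversionCovariant Δ S :=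
    h_InversionUpgradeNormalised ρ Δ S hρ hlim hnorm hnd heuc hsc
  have hmoeb : Literature.Probability.LatticeModels.IsMoebiusCovariant Δ S := ⟨heuc, hsc, hinv⟩
  -- (E): non-Gaussianity
  have hu4 : Literature.Probability.LatticeModels.HasNontrivialU4 S :=
    h_IsingEuclidUpgradeR4NonGaussian ρ S hρ hlim hnd
  exact ⟨ρ, Δ, S, hρ, hΔ, hlim, hnd, hmoeb, hu4⟩

end Summit.CriticalPhenomena.Ising3DConformalLimit.Theses.TauBallRounding
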